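import Summits.QuantumFields.BalabanUV.Beta.D1BFx.TadpoleRest
import Summits.QuantumFields.BalabanUV.Beta.D1BFx.DressedTadpoleTable
import Literature.MathematicalPhysics.QuantumFieldTheory.Balaban1983to89.Beta.LatticeConstantZl

/-!
# `BalabanUV.Beta.D1BFx.NeedleTadpoleRow` — road «BF-x» for binder row D1, slot (K), END row `hGrp gN` (NEEDLES ∪ G_R), (N-2) «NT-8»:
# **THE SLOT-4 TADPOLE TABLE ROW `h₈` OF `NeedleRowGlue.abs_gN_row_le_of_tables` (p255957) FROM LOCALITY OF THE TABLE** — leaf A6 ∕ `TadpoleRest`'s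
# generic tadpole word BY NAME at the full gluon leg `Ga n a` (entry bound `n²∕γ₀(4,a)`, `GluonLeg.abs_Ga_le`), averaged over the base sites; the
# n-uniformity isolated in ONE displayed scalar inequality on the weights, and made explicit under a scaling letter (tolerance `n⁶`)

HONEST DEPENDENCY (cell records, verbatim): «continuum YM on T⁴ ⇐ BetaPertH ∧ nine spine estimates (0/9 proved); BetaPertH ⇐ (D1) ∧ (D4) ∧
CAP+tail; G-an2-4 gates asym, D1 and NE2/3/4.»  HONEST FRAMING (cell contract, verbatim): «discharging `BetaPertH` makes Bałaban's UV stability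
UNCONDITIONAL — a real constructive-QFT result; it is NOT the continuum limit and NOT the Clay problem.»  THIS MODULE DISCHARGES NOTHING of the wall:
it is [folklore] bookkeeping BY NAME over leaf A6 (`ContactCount.abs_sum_mul_le_of_convex`), `TadpoleRest` §1 (`abs_fullSum_tadpoleWord_le`,
`conv_tadpoleWord_of_support`, `tadpoleT_nonneg` — leaf-03 g4), the owner's `Assembly` (`sum_uniform_resSite`, `uniform_resSite_nonneg`), T1
`GluonLeg.abs_Ga_le` and `LatticeConstantZl.Zl_anti`.  The slot-4 table `WQ`, the weights `ωgl`, `cQ₂` and all constants are ARBITRARY parameters: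
nothing about Bałaban's operators is asserted.  No `def`, no `def … : Prop`, nothing cited, 0 sorry.  Root-level binders hW ∕ hR-sockets ∕ hSX-socket ∕
D1Tel ∕ D1Rep — 0 discharged; (K) NOT closed; NOT D1, NOT `BetaPertH`, NOT continuum, NOT Clay.

ABSOLUTE RULE (cell charter, verbatim): «No internally-minted statement may enter as a cited fact. Every hypothesis is either kernel-proved in this
package or a verbatim quotation of a PUBLISHED theorem with page reference. The manuscript(s) under audit are NOT citable for their own disputed
steps — they are the thing under adjudication; programme-internal (2001/route/tribunal) claims are never citable.»

WHY (owner d1-p2-g9, «NEEDLE-GLUE» `NeedleRowGlue.abs_gN_row_le_of_tables` p255957, journal l.29099: «(N-2) = prove `h₁…h₈`; CLAIMABLE «NT-8» `h₈` (slot-4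
tadpole, LOCAL table `WQ` bi-localised at rate `δW`: the generic bound should give it outright — the warm-up word)»; an3-g56 (N-1) memo (V4): the
`Zl 4 (δ∕n)` route through the leg's decay costs `n⁴` twice — NOT taken here).  The row is
`h₈ : ∀ n ≥ 2, |ωgl n · cQ₂ n · Σ_{b ∈ image resSite} n⁻⁴ · (n⁻⁸ · fullSum (w ↦ w_μ w_ν · tadpoleTable n a (WQ n) μ ν (b+w) b))| ≤ C₈`.
Since `tadpoleTable n a W μ ν (b+w) b = baseKer (tadpoleTableA (Ga n a) W μ ν) b w` definitionally, leaf A6's mechanism applies VERBATIM when the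
slot table is LOCAL (the second-order vertex of a local operator couples only nearby bonds: `W κ u λ u′ = 0` for `‖u − u′‖∞ > ρ`): the word is
finitely supported in `w`, each coefficient sees the leg only through the SUP of its entries (`n²∕γ₀(4,a)`), no decay of the leg is spent, and the
base-point average is a convex combination.  The n-UNIFORMITY is EXACTLY the displayed inequality `hC₈` on `ωgl n · cQ₂ n`, `CQ n`, `δW n`, `ρ` —
the units question of slot (K), ruled NOWHERE in this file; §3 makes its n-power content explicit: under a rate floor `δ₀ ≤ δW n` the row tolerates
`|ωgl n · cQ₂ n| · CQ n ≤ k · n⁶`.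

CONTENT (all [folklore]; `T(ρ, C₀, Cw, δ) := (2ρ+1)⁴·(ρ²·(½·(4·(4·(C₀·Cw)·Zl 4 δ)·Zl 4 δ)))`, written out, never named).
* §1 `tadpoleTable_eq_baseKer` (`rfl`), **`abs_fullSum_tadpoleRow_le`** (generic fibre, entry-bounded leg, local bi-localised table:
  `|fullSum (w ↦ w_μw_ν·tadpoleTableA A W μ ν (b+w) b)| ≤ T(ρ, C₀, Cw, δ)`), `conv_tadpoleRow_of_support` ((CONV) from locality alone).
* §2 AT THE GLUON LEG, fixed `n`: **`abs_row₈_le`** — `|c · Σ_b n⁻⁴·(n⁻⁸·fullSum (…tadpoleTable n a W…))| ≤ |c|·(n⁻⁸·T(ρ, n²∕γ₀, Cw, δ))`.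
* §3 IN THE GLUE's CURRENCY (sequences): **`h₈_of_local`** (`hQ`, `hδW`, locality `hsupp`, ONE scalar inequality `hC₈` ⊢ `h₈` verbatim) and
  **`h₈_of_local_scaling`** (`δ₀ ≤ δW n`, `|ωgl n·cQ₂ n|·CQ n ≤ k·n⁶` ⊢ `h₈` with `C₈ := k·γ₀⁻¹·((2ρ+1)⁴·(ρ²·(8·(Zl 4 δ₀)²)))`).
Unit `b2b-balaban-beta-d1-formalise-leaf-04` (gen 8), D1 formalisation swarm; `LEAVES-BFx.md` row (N) ∕ (N-2) «NT-8».
-/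

noncomputable section

namespace Summit.QuantumFields.BalabanUV.Beta.D1BFx.NeedleTadpoleRow

open Finset Filter Topology
open scoped BigOperators
open Literature.MathematicalPhysics.QuantumFieldTheory.Balaban1983to89
open Literature.MathematicalPhysics.QuantumFieldTheory.Balaban1983to89.Beta
open Literature.MathematicalPhysics.QuantumFieldTheory.Balaban1983to89.B5Prop11Lattice (gammaZero gammaZero_pos)
open ExpKernelCalculus (Site MKer BiLoc Zl Zl_nonneg)
open LatticeConstantZl (Zl_anti)
open DyadicShell (Pt toReal supNorm)
open WindowIdentification (psum fullSum)
open DressedMomentNormalisation (resSite)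
open Summit.QuantumFields.BalabanUV.Beta.D1BFx.MomentTransferPeriodic (baseKer)
open Summit.QuantumFields.BalabanUV.Beta.D1BFx.GluonLeg (Ga abs_Ga_le)
open Summit.QuantumFields.BalabanUV.Beta.D1BFx.ReducedKernel (TableR)
open Summit.QuantumFields.BalabanUV.Beta.D1BFx.DressedTablesLeg (tadpoleTableA)
open Summit.QuantumFields.BalabanUV.Beta.D1BFx.DressedTadpoleTable (tadpoleTable)
open Summit.QuantumFields.BalabanUV.Beta.D1BFx.ContactCount (abs_sum_mul_le_of_convex)
open Summit.QuantumFields.BalabanUV.Beta.D1BFx.Assembly (sum_uniform_resSite uniform_resSite_nonneg)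
open Summit.QuantumFields.BalabanUV.Beta.D1BFx.TadpoleRest (abs_fullSum_tadpoleWord_le conv_tadpoleWord_of_support tadpoleT_nonneg)

/-! ## §1 The generic tadpole row at a base site (any fibre, entry-bounded leg, local bi-localised table) -/

section Generic

variable {F : Type*} [Fintype F] {A : MKer 4 F} {W : Fin 4 → Site 4 → Fin 4 → Site 4 → MKer 4 F} {C₀ Cw δ : ℝ} {ρ : ℕ}

/-- [folklore] The (1.22)-row integrand IS leaf A6's base-point tadpole word: `tadpoleTableA A W μ ν (b + w) b = baseKer (tadpoleTableA A W μ ν) b w`. -/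
theorem tadpoleTableA_eq_baseKer (μ ν : Fin 4) (b w : Pt) : tadpoleTableA A W μ ν (b + w) b = baseKer (tadpoleTableA A W μ ν) b w := rfl

/-- [folklore] **THE GENERIC TADPOLE ROW AT A BASE SITE HAS A BLOCK-SIZE-FREE WEIGHTED FULL SUM** (`TadpoleRest.abs_fullSum_tadpoleWord_le` at prefactor
`1`): entry-bounded leg `|A x y a b| ≤ C₀` (`C₀ ≥ 0`), table bi-localised at its two bonds at one common rate `(Cw, δ)`, `δ > 0`, and finitely supported in
the bond separation (`W κ u λ u′ = 0` for `ρ < ‖u − u′‖∞`) ⟹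
`|fullSum (w ↦ w_μ·w_ν·tadpoleTableA A W μ ν (b+w) b)| ≤ (2ρ+1)⁴·(ρ²·(½·(|F|·(|F|·(C₀·Cw)·Zl 4 δ)·Zl 4 δ)))` at EVERY base site `b`. -/
theorem abs_fullSum_tadpoleRow_le (hC₀ : 0 ≤ C₀) (hA : ∀ x y a b, |A x y a b| ≤ C₀) (hW : ∀ κ u l u', BiLoc (W κ u l u') u u' Cw δ)
    (hδ : 0 < δ) (hsupp : ∀ κ u l u', ρ < supNorm (u - u') → W κ u l u' = 0) (μ ν : Fin 4) (b : Pt) :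
    |fullSum (fun w : Pt => toReal w μ * toReal w ν * tadpoleTableA A W μ ν (b + w) b)| ≤
      (2 * (ρ : ℝ) + 1) ^ 4 *
        ((ρ : ℝ) ^ 2 * ((1 / 2 : ℝ) * ((Fintype.card F : ℝ) * ((Fintype.card F : ℝ) * (C₀ * Cw) * Zl 4 δ) * Zl 4 δ))) := by
  have h := abs_fullSum_tadpoleWord_le hC₀ hA hW hδ hsupp 1 μ ν b
  simpa only [one_mul, abs_one, baseKer] using h

/-- [folklore] **(CONV) FROM LOCALITY ALONE** for the row integrand: the punctured partial sums converge (eventually constant). -/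
theorem conv_tadpoleRow_of_support (hsupp : ∀ κ u l u', ρ < supNorm (u - u') → W κ u l u' = 0) (μ ν : Fin 4) (b : Pt) :
    ∃ B, Tendsto (psum (fun w : Pt => toReal w μ * toReal w ν * tadpoleTableA A W μ ν (b + w) b)) atTop (𝓝 B) := by
  have h := conv_tadpoleWord_of_support (A := A) hsupp 1 μ ν b
  simpa only [one_mul, baseKer] using h

end Generic

/-! ## §2 At the gluon leg, fixed block size: the base-point average -/

section Gluon

variable (n : ℕ) [NeZero n] (a : ℝ) {W : TableR} {Cw δ : ℝ} {ρ : ℕ}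

/-- [folklore] The slot table of `DressedTadpoleTable` IS the generic-leg table of `DressedTablesLeg` at `A := Ga n a` (definitionally). -/
theorem tadpoleTable_eq_tadpoleTableA (W : TableR) : tadpoleTable n a W = tadpoleTableA (Ga n a) W := rfl

/-- [folklore] **THE SLOT-4-TYPE TADPOLE ROW AT FIXED `n`, BASE-POINT AVERAGED** (uniform weights `n⁻⁴` on the residue sites are convex:
`Assembly.sum_uniform_resSite`; the leg enters only through T1's entry bound `|Ga| ≤ n²∕γ₀(4,a)`, `GluonLeg.abs_Ga_le`): for a LOCAL table `W` bi-localised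
at its bonds at rate `δ > 0` with constant `Cw` and bond-separation support `ρ`, and any scalar prefactor `c`,
`|c · Σ_{b ∈ image resSite} n⁻⁴·(n⁻⁸·fullSum (w ↦ w_μw_ν·tadpoleTable n a W μ ν (b+w) b))|`
`  ≤ |c|·(n⁻⁸·(2ρ+1)⁴·(ρ²·(½·(4·(4·((n²·γ₀⁻¹)·Cw)·Zl 4 δ)·Zl 4 δ))))`. -/
theorem abs_row₈_le (ha : 0 < a) (hW : ∀ κ u l u', BiLoc (W κ u l u') u u' Cw δ) (hδ : 0 < δ)
    (hsupp : ∀ κ u l u', ρ < supNorm (u - u') → W κ u l u' = 0) (c : ℝ) (μ ν : Fin 4) :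
    |c * ∑ b ∈ (univ : Finset (Fin 4 → Fin n)).image resSite, ((n : ℝ) ^ 4)⁻¹ * (((n : ℝ) ^ 8)⁻¹ *
        fullSum (fun w : Pt => toReal w μ * toReal w ν * tadpoleTable n a W μ ν (b + w) b))| ≤
      |c| * (((n : ℝ) ^ 8)⁻¹ * ((2 * (ρ : ℝ) + 1) ^ 4 *
        ((ρ : ℝ) ^ 2 * ((1 / 2 : ℝ) * ((4 : ℝ) * ((4 : ℝ) * ((((n : ℕ) : ℝ) ^ 2 * (gammaZero 4 a)⁻¹) * Cw) * Zl 4 δ) * Zl 4 δ))))) := by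
  have hn : 1 ≤ n := NeZero.one_le
  have hC₀ : 0 ≤ ((n : ℕ) : ℝ) ^ 2 * (gammaZero 4 a)⁻¹ := by
    have := gammaZero_pos (d := 4) (a := a)
    positivity
  have hword : ∀ b : Pt, |fullSum (fun w : Pt => toReal w μ * toReal w ν * tadpoleTable n a W μ ν (b + w) b)| ≤
      (2 * (ρ : ℝ) + 1) ^ 4 *
        ((ρ : ℝ) ^ 2 * ((1 / 2 : ℝ) * ((4 : ℝ) * ((4 : ℝ) * ((((n : ℕ) : ℝ) ^ 2 * (gammaZero 4 a)⁻¹) * Cw) * Zl 4 δ) * Zl 4 δ))) := by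
    intro b
    have h := abs_fullSum_tadpoleRow_le (A := Ga n a) (W := W) hC₀ (fun x y κ l => abs_Ga_le n a hn ha x y κ l) hW hδ hsupp μ ν b
    simpa only [tadpoleTable_eq_tadpoleTableA, Fintype.card_fin, Nat.cast_ofNat] using h
  have hT : 0 ≤ (2 * (ρ : ℝ) + 1) ^ 4 *
      ((ρ : ℝ) ^ 2 * ((1 / 2 : ℝ) * ((4 : ℝ) * ((4 : ℝ) * ((((n : ℕ) : ℝ) ^ 2 * (gammaZero 4 a)⁻¹) * Cw) * Zl 4 δ) * Zl 4 δ))) :=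
    (abs_nonneg _).trans (hword 0)
  rw [abs_mul]
  refine mul_le_mul_of_nonneg_left ?_ (abs_nonneg c)
  refine abs_sum_mul_le_of_convex _ (fun b hb => uniform_resSite_nonneg n b hb) (sum_uniform_resSite (NeZero.ne n)) fun b _ => ?_
  rw [abs_mul, abs_of_nonneg (by positivity : (0 : ℝ) ≤ ((n : ℝ) ^ 8)⁻¹)]
  exact mul_le_mul_of_nonneg_left (hword b) (by positivity)

/-- [folklore] (CONV) of the slot-4-type row integrand at every base site, from the locality of the table alone. -/
theorem conv_row₈_of_support (hsupp : ∀ κ u l u', ρ < supNorm (u - u') → W κ u l u' = 0) (μ ν : Fin 4) (b : Pt) :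
    ∃ B, Tendsto (psum (fun w : Pt => toReal w μ * toReal w ν * tadpoleTable n a W μ ν (b + w) b)) atTop (𝓝 B) := by
  rw [tadpoleTable_eq_tadpoleTableA]
  exact conv_tadpoleRow_of_support hsupp μ ν b

end Gluon

/-! ## §3 In the glue's currency: `h₈` of `NeedleRowGlue.abs_gN_row_le_of_tables` from locality + ONE displayed scalar inequality -/

section Glue

variable {a : ℝ} {WQ : ℕ → TableR} {CQ δW ωgl cQ₂ : ℕ → ℝ} {ρ : ℕ} {C₈ : ℝ}

/-- [folklore] **«NT-8»: THE SLOT-4 TADPOLE ROW `h₈` OF THE NEEDLE GROUP, FROM THE LOCALITY OF `WQ`** — displayed, for every block size: the glue's own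
table letter `hQ` (bi-localisation at the two bonds, `(CQ n, δW n)`, `δW n > 0`), the table's finite bond-separation support `ρ` (`hsupp`), and ONE scalar
inequality `hC₈` on the loop weight, the slot weight and the constants (slot (K)'s units; ruled nowhere here).  Output = `h₈` of
`NeedleRowGlue.abs_gN_row_le_of_tables` VERBATIM. -/
theorem h₈_of_local (ha : 0 < a) (hδW : ∀ n, 0 < δW n) (hQ : ∀ n κ u l u', BiLoc (WQ n κ u l u') u u' (CQ n) (δW n))
    (hsupp : ∀ n κ u l u', ρ < supNorm (u - u') → WQ n κ u l u' = 0)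
    (hC₈ : ∀ n : ℕ, 2 ≤ n → |ωgl n * cQ₂ n| * (((n : ℝ) ^ 8)⁻¹ * ((2 * (ρ : ℝ) + 1) ^ 4 *
        ((ρ : ℝ) ^ 2 * ((1 / 2 : ℝ) * ((4 : ℝ) * ((4 : ℝ) * ((((n : ℕ) : ℝ) ^ 2 * (gammaZero 4 a)⁻¹) * CQ n) * Zl 4 (δW n)) * Zl 4 (δW n)))))) ≤ C₈)
    (μ ν : Fin 4) :
    ∀ n : ℕ, 2 ≤ n → ∀ [NeZero n], |ωgl n * cQ₂ n * ∑ b ∈ (univ : Finset (Fin 4 → Fin n)).image resSite, ((n : ℝ) ^ 4)⁻¹ * (((n : ℝ) ^ 8)⁻¹ *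
      fullSum (fun w : Pt => toReal w μ * toReal w ν * tadpoleTable n a (WQ n) μ ν (b + w) b))| ≤ C₈ :=
  fun n hn _ => (abs_row₈_le n a ha (hQ n) (hδW n) (hsupp n) (ωgl n * cQ₂ n) μ ν).trans (hC₈ n hn)

/-- [folklore] **«NT-8» WITH THE n-POWER LEDGER EXPLICIT**: under a rate floor `0 < δ₀ ≤ δW n` and the scaling letter `|ωgl n · cQ₂ n| · CQ n ≤ k · n⁶`
(`n ≥ 2`), the row `h₈` holds with `C₈ := k · γ₀(4,a)⁻¹ · ((2ρ+1)⁴ · (ρ² · (8 · (Zl 4 δ₀)²)))` — the entry bound `n²∕γ₀` of the leg and the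
explicit `n⁻⁸`
leave a tolerance of exactly `n⁶` for the weights (`LatticeConstantZl.Zl_anti` for `Zl 4 (δW n) ≤ Zl 4 δ₀`). -/
theorem h₈_of_local_scaling (ha : 0 < a) {δ₀ k : ℝ} (hδ₀ : 0 < δ₀) (hδWge : ∀ n, δ₀ ≤ δW n)
    (hQ : ∀ n κ u l u', BiLoc (WQ n κ u l u') u u' (CQ n) (δW n))
    (hsupp : ∀ n κ u l u', ρ < supNorm (u - u') → WQ n κ u l u' = 0)
    (hk : ∀ n : ℕ, 2 ≤ n → |ωgl n * cQ₂ n| * CQ n ≤ k * (n : ℝ) ^ 6) (μ ν : Fin 4) :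
    ∀ n : ℕ, 2 ≤ n → ∀ [NeZero n], |ωgl n * cQ₂ n * ∑ b ∈ (univ : Finset (Fin 4 → Fin n)).image resSite, ((n : ℝ) ^ 4)⁻¹ * (((n : ℝ) ^ 8)⁻¹ *
      fullSum (fun w : Pt => toReal w μ * toReal w ν * tadpoleTable n a (WQ n) μ ν (b + w) b))| ≤
        k * (gammaZero 4 a)⁻¹ * ((2 * (ρ : ℝ) + 1) ^ 4 * ((ρ : ℝ) ^ 2 * (8 * (Zl 4 δ₀) ^ 2))) := by
  have hδW : ∀ n, 0 < δW n := fun n => hδ₀.trans_le (hδWge n)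
  refine h₈_of_local ha hδW hQ hsupp (fun n hn => ?_) μ ν
  have hγ : 0 < gammaZero 4 a := gammaZero_pos 4 a
  have hn0 : (n : ℝ) ≠ 0 := by exact_mod_cast (show n ≠ 0 by omega)
  have hCQ : 0 ≤ CQ n := (hQ n 0 0 0 0).nonneg 0
  have hZ0 : 0 ≤ Zl 4 (δW n) := Zl_nonneg (hδW n)
  have hZle : Zl 4 (δW n) ≤ Zl 4 δ₀ := Zl_anti hδ₀ (hδWge n)
  have hZsq : Zl 4 (δW n) * Zl 4 (δW n) ≤ (Zl 4 δ₀) ^ 2 := by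
    rw [sq]; exact mul_le_mul hZle hZle hZ0 (hZ0.trans hZle)
  have hk0 : 0 ≤ k * (n : ℝ) ^ 6 := (mul_nonneg (abs_nonneg _) hCQ).trans (hk n hn)
  -- regroup: the left side is `(|ωgl·cQ₂|·CQ) · (n²·n⁻⁸) · γ₀⁻¹ · (2ρ+1)⁴ · ρ² · 8 · Zl² `
  have e : |ωgl n * cQ₂ n| * (((n : ℝ) ^ 8)⁻¹ * ((2 * (ρ : ℝ) + 1) ^ 4 *
        ((ρ : ℝ) ^ 2 * ((1 / 2 : ℝ) * ((4 : ℝ) * ((4 : ℝ) * ((((n : ℕ) : ℝ) ^ 2 * (gammaZero 4 a)⁻¹) * CQ n) * Zl 4 (δW n)) * Zl 4 (δW n)))))) =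
      (|ωgl n * cQ₂ n| * CQ n) * (((n : ℝ) ^ 2 * ((n : ℝ) ^ 8)⁻¹) *
        ((gammaZero 4 a)⁻¹ * ((2 * (ρ : ℝ) + 1) ^ 4 * ((ρ : ℝ) ^ 2 * (8 * (Zl 4 (δW n) * Zl 4 (δW n))))))) := by
    ring
  rw [e]
  have hR : (gammaZero 4 a)⁻¹ * ((2 * (ρ : ℝ) + 1) ^ 4 * ((ρ : ℝ) ^ 2 * (8 * (Zl 4 (δW n) * Zl 4 (δW n))))) ≤
      (gammaZero 4 a)⁻¹ * ((2 * (ρ : ℝ) + 1) ^ 4 * ((ρ : ℝ) ^ 2 * (8 * (Zl 4 δ₀) ^ 2))) := by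
    gcongr
  have hR0 : 0 ≤ (gammaZero 4 a)⁻¹ * ((2 * (ρ : ℝ) + 1) ^ 4 * ((ρ : ℝ) ^ 2 * (8 * (Zl 4 (δW n) * Zl 4 (δW n))))) := by positivity
  have hpow : 0 ≤ (n : ℝ) ^ 2 * ((n : ℝ) ^ 8)⁻¹ := by positivity
  calc (|ωgl n * cQ₂ n| * CQ n) * (((n : ℝ) ^ 2 * ((n : ℝ) ^ 8)⁻¹) *
        ((gammaZero 4 a)⁻¹ * ((2 * (ρ : ℝ) + 1) ^ 4 * ((ρ : ℝ) ^ 2 * (8 * (Zl 4 (δW n) * Zl 4 (δW n)))))))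
      ≤ (k * (n : ℝ) ^ 6) * (((n : ℝ) ^ 2 * ((n : ℝ) ^ 8)⁻¹) *
        ((gammaZero 4 a)⁻¹ * ((2 * (ρ : ℝ) + 1) ^ 4 * ((ρ : ℝ) ^ 2 * (8 * (Zl 4 δ₀) ^ 2))))) :=
        mul_le_mul (hk n hn) (mul_le_mul_of_nonneg_left hR hpow) (mul_nonneg hpow hR0) hk0
    _ = k * (gammaZero 4 a)⁻¹ * ((2 * (ρ : ℝ) + 1) ^ 4 * ((ρ : ℝ) ^ 2 * (8 * (Zl 4 δ₀) ^ 2))) := by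
        field_simp

end Glue

end Summit.QuantumFields.BalabanUV.Beta.D1BFx.NeedleTadpoleRow

end
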